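import Mathlib

/-!
# The weights of the one-factor relay step of (SD) at `(2,0)`, and their coverage identities
(seat mine-b, cell pub-perc-repro2; conjectures/MINE-B.md §45)

Pure rational arithmetic in the five atoms `a = #R_X`, `c = #C_X` of the flow-one factor and `D = #D_Y(1,0)`,
`S = T_Y(1,1)`, `T = T_Y(2,0)` of the other factor (`T_Y(1,0) = T_Y(0,1) = D + S`): the counts
`#E(2,0) = a (D + S) + (a + c) T` (`relayE`) and `#E(1,1) = 2a (D + S) + c S` (`relayE'`), the margins
`Δ = S (D + S + T) − 2 (D + S) T` (`relayΔ`) and `K = (D + S) S #E − c D Δ` (`relayK`), the eight weights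
`relayW` (stay, flip, relax from `E_Y(1,1) × R`; two Harris moves and a flip from `D_Y(1,0) × R`; the (SD) move
from `E_Y(2,0) × C`; the red-axis move from `E_Y(2,0) × B`), their non-negativity from `T ≤ S ≤ 2T` and `Δ ≥ 0`
(`relayW_nonneg`), and the nine density identities of the source and target coverage (`relay_src*`, `relay_tgt*`),
each a rational identity closed by `field_simp; ring`.
-/

namespace Summit.Ventures.PercRepro2.Tail2D

section Weights

/-- `#E(2,0)` of `X ∥ Y` in the atoms `a = #R_X`, `c = #C_X`, `D = #D_Y(1,0)`, `S = T_Y(1,1)`, `T = T_Y(2,0)` -/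
def relayE (a c D S T : ℚ) : ℚ := a * (D + S) + (a + c) * T
/-- `#E(1,1)` of `X ∥ Y` in the atoms -/
def relayE' (a c D S : ℚ) : ℚ := 2 * a * (D + S) + c * S
/-- the margin `Δ = T₁₁ (T₁ + T₂₀) − 2 T₁ T₂₀` of `Y`, `T₁ = D + S` -/
def relayΔ (D S T : ℚ) : ℚ := S * (D + S + T) - 2 * (D + S) * T
/-- the margin `K = T₁ T₁₁ #E − c #D Δ` of the identity move -/
def relayK (a c D S T : ℚ) : ℚ := (D + S) * S * relayE a c D S T - c * D * relayΔ D S T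

/-- the eight weights of the relay: stay, flip, relax (from `E_Y(1,1) × R`); Harris to `E_Y(0,1) × R`, flip,
Harris to `Dc_Y(0,1) × R` (from `D_Y(1,0) × R`); (SD) of `Y` (from `E_Y(2,0) × C`); the red axis of `Y`
(from `E_Y(2,0) × B`) -/
def relayW (a c D S T : ℚ) : Fin 8 → ℚ :=
  ![a * relayK a c D S T / ((D + S) * relayE a c D S T * relayE' a c D S),
    a * T * D / ((D + S) * relayE a c D S T),
    (a + c) * (S / relayE' a c D S - T / relayE a c D S T),
    a * c * D * relayΔ D S T / (S * relayE a c D S T * relayE' a c D S),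
    a * D * (1 / relayE' a c D S - T / ((D + S) * relayE a c D S T)),
    a * D * relayK a c D S T / ((D + S) * S * relayE a c D S T * relayE' a c D S),
    c * T / relayE a c D S T,
    a * T / relayE a c D S T]

variable {a c D S T : ℚ}

/-- `#E(2,0) > 0` -/
theorem relayE_pos (ha : 0 < a) (hc : 0 ≤ c) (hD : 0 ≤ D) (hS : 0 < S) (hT : 0 ≤ T) : 0 < relayE a c D S T := by
  unfold relayE; positivity
/-- `#E(1,1) > 0` -/
theorem relayE'_pos (ha : 0 < a) (hc : 0 ≤ c) (hD : 0 ≤ D) (hS : 0 < S) : 0 < relayE' a c D S := by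
  unfold relayE'; positivity

/-- `K ≥ 0` from `T ≤ S ≤ 2T` -/
theorem relayK_nonneg (ha : 0 ≤ a) (hc : 0 ≤ c) (hD : 0 ≤ D) (hS : 0 ≤ S) (hT : 0 ≤ T)
    (hS2 : S ≤ 2 * T) : 0 ≤ relayK a c D S T := by
  unfold relayK relayΔ relayE
  have hDS : 0 ≤ D + S := by linarith
  have h1 : D * (S * (D + S + T) - 2 * (D + S) * T) ≤ (D + S) * S * T := by
    have e : D * (S * (D + S + T) - 2 * (D + S) * T) = D * S * T - D * (D + S) * (2 * T - S) := by ring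
    rw [e]
    nlinarith [mul_nonneg (mul_nonneg hD hDS) (by linarith : (0:ℚ) ≤ 2 * T - S),
      mul_nonneg (mul_nonneg hS hS) hT]
  have h2 := mul_le_mul_of_nonneg_left h1 hc
  have h3 : 0 ≤ (D + S) * S * (a * (D + S + T)) :=
    mul_nonneg (mul_nonneg hDS hS) (mul_nonneg ha (by linarith))
  nlinarith [h2, h3]

/-- the weights are non-negative -/
theorem relayW_nonneg (ha : 0 < a) (hc : 0 ≤ c) (hD : 0 ≤ D) (hS : 0 < S) (hT : 0 ≤ T) (hTS : T ≤ S)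
    (hS2 : S ≤ 2 * T) (hΔ : 0 ≤ relayΔ D S T) (k : Fin 8) : 0 ≤ relayW a c D S T k := by
  have hE := relayE_pos ha hc hD hS hT
  have hE' := relayE'_pos ha hc hD hS
  have hK := relayK_nonneg ha.le hc hD hS.le hT hS2
  have hDS : 0 < D + S := by linarith
  fin_cases k
  · show 0 ≤ a * relayK a c D S T / ((D + S) * relayE a c D S T * relayE' a c D S); positivity
  · show 0 ≤ a * T * D / ((D + S) * relayE a c D S T); positivity
  · show 0 ≤ (a + c) * (S / relayE' a c D S - T / relayE a c D S T)
    refine mul_nonneg (by linarith) ?_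
    rw [sub_nonneg, div_le_div_iff₀ hE hE']
    unfold relayΔ at hΔ; unfold relayE relayE'
    nlinarith
  · show 0 ≤ a * c * D * relayΔ D S T / (S * relayE a c D S T * relayE' a c D S); positivity
  · show 0 ≤ a * D * (1 / relayE' a c D S - T / ((D + S) * relayE a c D S T))
    refine mul_nonneg (by positivity) ?_
    rw [sub_nonneg, div_le_div_iff₀ (by positivity) hE']
    unfold relayE relayE'
    nlinarith [mul_nonneg hc (mul_nonneg hD hT), mul_nonneg ha.le (mul_nonneg hDS.le (by linarith : (0:ℚ) ≤ D + S - T))]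
  · show 0 ≤ a * D * relayK a c D S T / ((D + S) * S * relayE a c D S T * relayE' a c D S); positivity
  · show 0 ≤ c * T / relayE a c D S T; positivity
  · show 0 ≤ a * T / relayE a c D S T; positivity

/-- source coverage on `E_Y(1,1) × R` (the identity, flip and relax moves) -/
theorem relay_srcA (ha : a ≠ 0) (hS : S ≠ 0) (hDS : D + S ≠ 0) (hE : relayE a c D S T ≠ 0)
    (hE' : relayE' a c D S ≠ 0) :
    relayW a c D S T 0 * (S⁻¹ * a⁻¹) + (relayW a c D S T 1 * (S⁻¹ * a⁻¹) + relayW a c D S T 2 * (S⁻¹ * a⁻¹))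
      = (relayE a c D S T)⁻¹ := by
  simp only [relayW, relayK, Matrix.cons_val]
  field_simp
  try unfold relayE
  try unfold relayE'
  try unfold relayΔ
  ring

/-- source coverage on `D_Y(1,0) × R` (the two Harris moves and the flip) -/
theorem relay_srcB (ha : a ≠ 0) (hS : S ≠ 0) (hD : D ≠ 0) (hDS : D + S ≠ 0) (hE : relayE a c D S T ≠ 0)
    (hE' : relayE' a c D S ≠ 0) :
    relayW a c D S T 3 * (D⁻¹ * a⁻¹) + (relayW a c D S T 4 * (D⁻¹ * a⁻¹) + relayW a c D S T 5 * (D⁻¹ * a⁻¹))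
      = (relayE a c D S T)⁻¹ := by
  simp only [relayW, relayK, Matrix.cons_val]
  field_simp
  try unfold relayE
  try unfold relayE'
  try unfold relayΔ
  ring

/-- source coverage on `E_Y(2,0) × C` (the (SD) move of `Y`) -/
theorem relay_srcC (hc : c ≠ 0) (hT : T ≠ 0) (hE : relayE a c D S T ≠ 0) :
    relayW a c D S T 6 * (T⁻¹ * c⁻¹) = (relayE a c D S T)⁻¹ := by
  simp only [relayW, Matrix.cons_val]
  field_simp

/-- source coverage on `E_Y(2,0) × B` (the red-axis move of `Y`) -/
theorem relay_srcD (ha : a ≠ 0) (hT : T ≠ 0) (hE : relayE a c D S T ≠ 0) :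
    relayW a c D S T 7 * (T⁻¹ * a⁻¹) = (relayE a c D S T)⁻¹ := by
  simp only [relayW, Matrix.cons_val]
  field_simp

/-- target coverage on `E_Y(1,1) × R` -/
theorem relay_tgtA (ha : a ≠ 0) (hS : S ≠ 0) (hDS : D + S ≠ 0) (hE : relayE a c D S T ≠ 0)
    (hE' : relayE' a c D S ≠ 0) :
    relayW a c D S T 0 * (S⁻¹ * a⁻¹) + relayW a c D S T 3 * ((D + S)⁻¹ * a⁻¹) = (relayE' a c D S)⁻¹ := by
  simp only [relayW, relayK, Matrix.cons_val]
  field_simp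
  try unfold relayE
  try unfold relayE'
  try unfold relayΔ
  ring

/-- target coverage on `Dc_Y(0,1) × R` -/
theorem relay_tgtB (ha : a ≠ 0) (hS : S ≠ 0) (hD : D ≠ 0) (hDS : D + S ≠ 0) (hE : relayE a c D S T ≠ 0)
    (hE' : relayE' a c D S ≠ 0) :
    relayW a c D S T 3 * ((D + S)⁻¹ * a⁻¹) + relayW a c D S T 5 * (D⁻¹ * a⁻¹) = (relayE' a c D S)⁻¹ := by
  simp only [relayW, relayK, Matrix.cons_val]
  field_simp
  try unfold relayE
  try unfold relayE'
  try unfold relayΔ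
  ring

/-- target coverage on `E_Y(1,1) × C` -/
theorem relay_tgtC (hc : c ≠ 0) (hca : c + a ≠ 0) (hS : S ≠ 0) (hE : relayE a c D S T ≠ 0)
    (hE' : relayE' a c D S ≠ 0) :
    relayW a c D S T 2 * (S⁻¹ * (c + a)⁻¹) + relayW a c D S T 6 * (S⁻¹ * c⁻¹) = (relayE' a c D S)⁻¹ := by
  simp only [relayW, relayK, Matrix.cons_val]
  field_simp
  try unfold relayE
  try unfold relayE'
  try unfold relayΔ
  ring

/-- target coverage on `E_Y(1,1) × B` -/
theorem relay_tgtD1 (ha : a ≠ 0) (hS : S ≠ 0) (hDS : D + S ≠ 0) (hca : c + a ≠ 0) (hE : relayE a c D S T ≠ 0)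
    (hE' : relayE' a c D S ≠ 0) :
    relayW a c D S T 1 * (S⁻¹ * a⁻¹)
      + (relayW a c D S T 2 * (S⁻¹ * (c + a)⁻¹) + relayW a c D S T 7 * ((D + S)⁻¹ * a⁻¹))
      = (relayE' a c D S)⁻¹ := by
  simp only [relayW, relayK, Matrix.cons_val]
  field_simp
  try unfold relayE
  try unfold relayE'
  try unfold relayΔ
  ring

/-- target coverage on `D_Y(1,0) × B` -/
theorem relay_tgtD2 (ha : a ≠ 0) (hD : D ≠ 0) (hDS : D + S ≠ 0) (hE : relayE a c D S T ≠ 0)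
    (hE' : relayE' a c D S ≠ 0) :
    relayW a c D S T 4 * (D⁻¹ * a⁻¹) + relayW a c D S T 7 * ((D + S)⁻¹ * a⁻¹) = (relayE' a c D S)⁻¹ := by
  simp only [relayW, relayK, Matrix.cons_val]
  field_simp
  try unfold relayE
  try unfold relayE'
  try unfold relayΔ
  ring

end Weights

end Summit.Ventures.PercRepro2.Tail2D
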